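import Summits.ResolutionOfSingularities.ResolutionOfSingularities.Theorems.FrobeniusLadderFRationalResolutionFixedChartsOfCharts
import Summits.ResolutionOfSingularities.ResolutionOfSingularities.Theorems.FrobeniusLadderFRationalResolutionFixedPointCompletionChart
import HarnessLib

/-!
# Crux `FrobeniusLadder.FRationalResolution` (stmt-ResolutionOfSingularities-15317), line `redirect`,
# stub `stub_diagonalizableQuotientResolution` — under the stub's hypothesis `hq` VERBATIM, `X` is FORMALLY TORIC AT EVERY POINT: every
# `x ∈ X` is the image of a point `v` of an étale quotient chart `Spec S₀ → X` at which `((S₀)_v)^ ≅ κ(v)⟦P⟧` for a weight-kernel monoid `P`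

Composition of this generation's `…FixedChartsOfCharts.fixed_charts_of_charts` (every point is under a FIXED point of a chart) with g20's
formal linearisation at fixed points `…FixedPointCompletionChart.exists_ringEquiv_monoidPowerSeries_adicCompletion_of_fixed` (Kato (3.2)(1)
with Cohen coefficient field; any residue field, any characteristic):

* ★★★★★ `formally_toric_of_charts` — for every `x ∈ X`: a chart `(A, S, 𝒮, φ)` of `hq`'s shape, a point `v` with `φ v = x`, a fixed prime
  `𝔔` over `v`, and for ANY local ring `Rq` of `Spec S₀` at `v` (= localization at `𝔔 ∩ S₀`): homogeneous `x₁,…,x_n ∈ 𝔔` (`n = dim S_𝔔 = dim Rq`), their weight kernel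
  `P = {m : Σ mᵢ • deg xᵢ = 0}` (finitely generated of rank `n`) and a ring isomorphism `κ(Rq)⟦P⟧ ≃+* Rq^` sending `χ^m ↦ x^m`.

So every singularity in the class of the stub is analytically a (not necessarily normal-crossings) TORIC singularity `κ⟦P⟧` over its own
residue field, seen through an étale chart — the input format of the cone / fan certificates (`…FixedPointResolutionModel`,
`…ToricModelTransfer`). Honest label: helper toward ONE leaf stub; no stub, crux or summit closed. No definitions, no named facts, no sorry.
[cite: Kato1994, Thm. (3.2)] [cite: Matsumura1987, Thm. 28.3; §29] [folklore; cite: SGA3, Exp. VIII §4–5]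
-/

noncomputable section

-- single-problem summit: the doubled namespace component is forced
set_option linter.dupNamespace false

open CategoryTheory AlgebraicGeometry IsLocalRing
open Literature.RingTheory.MvPowerSeries Literature.RingTheory.MvPowerSeries.monoidPowerSeries
open Literature.AlgebraicGeometry.Resolution

namespace Summit.ResolutionOfSingularities.ResolutionOfSingularities.Theorems.FRationalResolution.FormalToricOfCharts

/-- ★★★★★ **`hq ⇒ formally toric at every point.** See the module docstring. [cite: Kato1994, Thm. (3.2)]
[cite: Matsumura1987, Thm. 28.3; §29] [folklore; cite: SGA3, Exp. VIII §4–5] -/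
theorem formally_toric_of_charts (k : Type) [Field k] (X : Scheme.{0}) (g : X ⟶ Spec (.of k))
    (hq : ∀ x : X, ∃ (A : Type) (_ : AddCommGroup A) (_ : Finite A) (_ : DecidableEq A)
        (S : Type) (_ : CommRing S) (_ : Algebra k S) (𝒮 : A → Submodule k S)
        (_ : GradedAlgebra 𝒮), Algebra.FiniteType k S ∧ IsRegularRing S ∧
        ∃ φ : Spec (.of (𝒮 0)) ⟶ X, Etale φ ∧ x ∈ Set.range φ ∧
          φ ≫ g = Spec.map (CommRingCat.ofHom (algebraMap k (𝒮 0))))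
    (x : X) :
    ∃ (A : Type) (_ : AddCommGroup A) (_ : Finite A) (_ : DecidableEq A)
      (S : Type) (_ : CommRing S) (_ : Algebra k S) (𝒮 : A → Submodule k S) (_ : GradedAlgebra 𝒮),
      Algebra.FiniteType k S ∧ IsRegularRing S ∧
      ∃ (φ : Spec (.of (𝒮 0)) ⟶ X), Etale φ ∧
        φ ≫ g = Spec.map (CommRingCat.ofHom (algebraMap k (𝒮 0))) ∧
        ∃ (v : Spec (.of (𝒮 0))) (𝔔 : Ideal S) (_ : 𝔔.IsPrime),
          𝔔.comap (algebraMap (𝒮 0) S) = v.asIdeal ∧ (∀ c : A, c ≠ 0 → ∀ s ∈ 𝒮 c, s ∈ 𝔔) ∧ φ v = x ∧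
          ∀ (Rq : Type) [CommRing Rq] [Algebra (𝒮 0) Rq] [IsLocalization.AtPrime Rq (𝔔.comap (algebraMap (𝒮 0) S))]
            [IsLocalRing Rq],
            ∃ (n : ℕ) (y : Fin n → S) (a : Fin n → A) (P : AddSubmonoid (Fin n →₀ ℕ)) (χ : (Fin n →₀ ℕ) → 𝒮 0),
              (∀ i, y i ∈ 𝔔 ∧ y i ∈ 𝒮 (a i)) ∧ (n : WithBot ℕ∞) = ringKrullDim (Localization.AtPrime 𝔔) ∧
              ringKrullDim Rq = n ∧ (∀ m, m ∈ P ↔ Finsupp.weight a m = 0) ∧ P.FG ∧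
              rank P = n ∧ (∀ m ∈ P, ((χ m : 𝒮 0) : S) = ∏ i, y i ^ m i) ∧
              ∃ e : ↥(monoidPowerSeries (ResidueField Rq) P) ≃+* AdicCompletion (maximalIdeal Rq) Rq,
                ∀ (m : Fin n →₀ ℕ) (hm : m ∈ P),
                  e ⟨MvPowerSeries.monomial m 1, monomial_mem hm 1⟩ =
                    algebraMap Rq (AdicCompletion (maximalIdeal Rq) Rq) (algebraMap (𝒮 0) Rq (χ m)) := by
  obtain ⟨A, iA, fA, dA, S, iS, aS, 𝒮, g𝒮, hft, hreg, φ, hφ, hcomp, v, 𝔔, h𝔔p, h𝔔v, hfix, hφv⟩ :=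
    FixedChartsOfCharts.fixed_charts_of_charts k X g hq x
  haveI := hft
  haveI := hreg
  haveI := h𝔔p
  have hA : AddMonoid.IsTorsion A := fun i => isOfFinAddOrder_of_finite i
  refine ⟨A, iA, fA, dA, S, iS, aS, 𝒮, g𝒮, hft, hreg, φ, hφ, hcomp, v, 𝔔, h𝔔p, h𝔔v, hfix, hφv, fun Rq _ _ _ _ => ?_⟩
  exact FixedPointCompletionChart.exists_ringEquiv_monoidPowerSeries_adicCompletion_of_fixed 𝒮 hA 𝔔 hfix Rq

end Summit.ResolutionOfSingularities.ResolutionOfSingularities.Theorems.FRationalResolution.FormalToricOfCharts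

end
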